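import Summits.RiemannHypothesis.RiemannHypothesis.Theorems.MotivicDoorFfLatticeFloor
import Summits.RiemannHypothesis.RiemannHypothesis.Theorems.MotivicDoorFfDictionary

/-!
# The window form as a REAL quadratic form: `T_M(q,h) ⪰ 0` ⟺ `Σ q^{min(m,m')} s_{|m-m'|} c_m c_{m'} ≥ 0`
(pub-rhdoor, unit `ffcal`, generation 4, file 1 of 2.  HONEST FRAMING: lottery ticket at the motivic door;
RH probability negligible; consolation prizes are real: a new semi-local Weil-positivity theorem, or a located
gap in the Connes–Consani programme, plus the ff-door theorem.  Nothing here is about `ζ`: "RH(q,h)" is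
`|α| = √q` for the complex roots of ONE integer polynomial `h`, always a hypothesis or a conclusion.)

The tree states window positivity as `Matrix.PosSemidef` of the COMPLEX Toeplitz matrix
`T_M(q,h) = weilWindowForm q h M` (`PfPersistenceFfAngleTwin`), and `MotivicDoorFfLatticeFloor` rescales it
to the lattice matrix `S_M = D (2 T_M) D = (q^{min(m,m')} s_{|m-m'|})` (`latticeMatrix_eq`).  Weil's 1948
argument, and the calibration `FFCAL.md` (clauses A4/A5), live on the REAL side: `S_M` is a real symmetric
matrix (integral for monic `h`, `powerSum_frobRoots_mem_intRange`) and what geometry delivers is the sign of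
the real quadratic form `c ↦ cᵀ S_M c` on integer / real coefficient vectors (divisor classes
`Σ c_m Γ_m`).  This file is the glue, so that the companion file `MotivicDoorFfHodgeIndex` can speak about
formal divisors with real coefficients and still conclude about `weilWindowForm`.

## Results (all PROVED, 0 sorry; `q ∈ ℕ`; `h ∈ ℤ[X]` arbitrary unless stated)

* `posSemidef_map_ofReal_iff` — API: a real symmetric `S` has `(S.map (ℝ → ℂ)).PosSemidef` iff
  `∀ c : n → ℝ, 0 ≤ cᵀ S c` (via `x̄ᵀ S x = aᵀ S a + bᵀ S b` for `x = a + ib`, `star_dotProduct_map_mulVec_eq`).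
* `powerSum_frobRoots_im` — the power sums `s_n` of `frobRoots h` are real (`frobRoots_map_conj`).
* `realLattice`, `realLattice_map_ofReal` — `S_M^ℝ := (q^{min} Re s_{|m-m'|})`, and `S_M^ℝ ⊗ ℂ = latticeMatrix`.
* `latticeMatrix_posSemidef_iff` — `D (2T) D ⪰ 0 ↔ T ⪰ 0` (`q > 0`; `D` real invertible diagonal).
* `realLattice_nonneg_iff_posSemidef` — for `q > 0`:  `(∀ c, cᵀ S_M^ℝ c ≥ 0) ↔ T_M(q,h) ⪰ 0`.
* `realLattice_nonneg_of_ffRH`, `ffRH_iff_forall_realLattice_nonneg`, `ffRH_iff_realLattice_nonneg_lastWindow`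
  — RH(q,h) ⇒ every `S_M^ℝ` is a nonnegative form; for an HONEST datum (`deg h = 2g`, coefficient functional
  equation) RH(q,h) ⟺ all `S_M^ℝ ≥ 0` ⟺ the single form `S_{2g-1}^ℝ ≥ 0` (ff-1 / ffmirror-2's
  `weilWindowForm_posSemidef_depth_iff_ffRH`, `…_lastWindow_iff_ffRH`, transported).  This is Weil's
  positivity `Σ_{m,m'} c_m c_{m'} q^{min} s_{|m-m'|} ≥ 0` in its original lattice normalisation.

Honest grade: folklore linear algebra; new only as kernel glue binding the cell's complex `PosSemidef`
convention to real quadratic forms BY NAME.  References: A. Weil, *Sur les courbes algébriques et les variétés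
qui s'en déduisent* (Hermann 1948); M. van Frankenhuijsen, *The Riemann Hypothesis for function fields*
(CUP 2014) [corpus: held]; E. Hallouin, M. Perret, Trans. AMS 372 (2019) 5409–5451 [corpus:
paper:doi-10-1090-tran-7813].
-/

set_option linter.dupNamespace false

noncomputable section

open Polynomial Matrix Finset
open scoped ComplexOrder

open Summit.RiemannHypothesis.RiemannHypothesis.Theorems.PfPersistence.FfAngleTwin
open Summit.RiemannHypothesis.RiemannHypothesis.Theorems.MotivicDoor.FfLatticeFloor
open Summit.RiemannHypothesis.RiemannHypothesis.Theorems.MotivicDoor.FunctionField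

namespace Summit.RiemannHypothesis.RiemannHypothesis.Theorems.MotivicDoor.FfRealLattice

/-! ## Real quadratic forms and complex positive semidefiniteness (API glue) -/

section RealForm

variable {n : Type*} [Fintype n]

/-- `cᵀ S d` as a double sum. [folklore] -/
theorem dotProduct_mulVec_eq_sum_sum (S : Matrix n n ℝ) (c d : n → ℝ) :
    c ⬝ᵥ (S *ᵥ d) = ∑ i, ∑ j, S i j * (c i * d j) := by
  simp only [dotProduct, mulVec, Finset.mul_sum]
  exact Finset.sum_congr rfl fun i _ => Finset.sum_congr rfl fun j _ => by ring

/-- The complex form of a real matrix on a complex vector, as a double sum. [folklore] -/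
theorem star_dotProduct_map_mulVec_eq_sum_sum (S : Matrix n n ℝ) (x : n → ℂ) :
    star x ⬝ᵥ (S.map ((↑) : ℝ → ℂ) *ᵥ x) = ∑ i, ∑ j, (starRingEnd ℂ) (x i) * ((S i j : ℂ) * x j) := by
  simp only [dotProduct, mulVec, Matrix.map_apply, Finset.mul_sum, Pi.star_apply, Complex.star_def]

/-- The antisymmetric double sum of a symmetric matrix vanishes. [folklore] -/
theorem sum_sum_mul_sub_eq_zero {S : Matrix n n ℝ} (hS : S.IsSymm) (a b : n → ℝ) :
    ∑ i, ∑ j, S i j * (a i * b j - b i * a j) = 0 := by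
  have h1 : ∑ i, ∑ j, S i j * (b i * a j) = ∑ i, ∑ j, S i j * (a i * b j) := by
    rw [Finset.sum_comm]
    refine Finset.sum_congr rfl fun i _ => Finset.sum_congr rfl fun j _ => ?_
    rw [hS.apply i j]; ring
  simp only [mul_sub, Finset.sum_sub_distrib, h1, sub_self]

/-- For a real SYMMETRIC `S` and a complex vector `x = a + ib`:  `x̄ᵀ S x = aᵀ S a + bᵀ S b` (real).
[folklore] -/
theorem star_dotProduct_map_mulVec_eq {S : Matrix n n ℝ} (hS : S.IsSymm) (x : n → ℂ) :
    star x ⬝ᵥ (S.map ((↑) : ℝ → ℂ) *ᵥ x)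
      = (((fun i => (x i).re) ⬝ᵥ (S *ᵥ fun i => (x i).re)
          + (fun i => (x i).im) ⬝ᵥ (S *ᵥ fun i => (x i).im) : ℝ) : ℂ) := by
  rw [star_dotProduct_map_mulVec_eq_sum_sum, dotProduct_mulVec_eq_sum_sum, dotProduct_mulVec_eq_sum_sum,
    ← Finset.sum_add_distrib]
  apply Complex.ext
  · rw [Complex.ofReal_re, Complex.re_sum]
    refine Finset.sum_congr rfl fun i _ => ?_
    rw [Complex.re_sum, ← Finset.sum_add_distrib]
    refine Finset.sum_congr rfl fun j _ => ?_
    simp only [Complex.mul_re, Complex.mul_im, Complex.conj_re, Complex.conj_im, Complex.ofReal_re,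
      Complex.ofReal_im]
    ring
  · rw [Complex.ofReal_im, Complex.im_sum, ← sum_sum_mul_sub_eq_zero hS (fun i => (x i).re) (fun i => (x i).im)]
    refine Finset.sum_congr rfl fun i _ => ?_
    rw [Complex.im_sum]
    refine Finset.sum_congr rfl fun j _ => ?_
    simp only [Complex.mul_re, Complex.mul_im, Complex.conj_re, Complex.conj_im, Complex.ofReal_re,
      Complex.ofReal_im]
    ring

/-- A real symmetric matrix is positive semidefinite as a COMPLEX matrix (`Matrix.PosSemidef` of its image
under `ℝ → ℂ`, the tree's convention for window forms) iff its real quadratic form is nonnegative.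
[folklore] -/
theorem posSemidef_map_ofReal_iff {S : Matrix n n ℝ} (hS : S.IsSymm) :
    (S.map ((↑) : ℝ → ℂ)).PosSemidef ↔ ∀ c : n → ℝ, 0 ≤ c ⬝ᵥ (S *ᵥ c) := by
  rw [Matrix.posSemidef_iff_dotProduct_mulVec]
  constructor
  · rintro ⟨-, hpos⟩ c
    have h1 := hpos fun i => (c i : ℂ)
    have hre : (fun i => ((c i : ℂ)).re) = c := funext fun i => Complex.ofReal_re _
    have him : (fun i => ((c i : ℂ)).im) = 0 := funext fun i => Complex.ofReal_im _
    rw [star_dotProduct_map_mulVec_eq hS, hre, him, zero_dotProduct, add_zero, Complex.zero_le_real] at h1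
    exact h1
  · intro hc
    refine ⟨Matrix.IsHermitian.ext fun i j => ?_, fun x => ?_⟩
    · simp only [Matrix.map_apply, Complex.star_def, Complex.conj_ofReal, hS.apply i j]
    · rw [star_dotProduct_map_mulVec_eq hS]
      exact Complex.zero_le_real.2 (add_nonneg (hc _) (hc _))

end RealForm

/-- `2 • T ⪰ 0 ↔ T ⪰ 0` over `ℂ`. [folklore] -/
theorem posSemidef_two_smul_iff {n : Type*} {T : Matrix n n ℂ} : ((2 : ℂ) • T).PosSemidef ↔ T.PosSemidef := by
  have h2 : (0 : ℂ) ≤ 2 := by exact_mod_cast Complex.zero_le_real.2 (by norm_num : (0 : ℝ) ≤ 2)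
  have hhalf : (0 : ℂ) ≤ 2⁻¹ := by
    have e : ((2⁻¹ : ℝ) : ℂ) = 2⁻¹ := by simp
    rw [← e]; exact Complex.zero_le_real.2 (by norm_num)
  refine ⟨fun h => ?_, fun h => h.smul h2⟩
  have := h.smul hhalf
  rwa [smul_smul, inv_mul_cancel₀ (two_ne_zero' ℂ), one_smul] at this

/-! ## The real lattice matrix of a datum `(q, h)` -/

/-- The REAL LATTICE MATRIX `S_M = (q^{min(m,m')} Re s_{|m-m'|})_{m,m' ≤ M}` — the real form of
`latticeMatrix q (frobRoots h) M = D (2 T_M) D` (`realLattice_map_ofReal`). [folklore] -/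
def realLattice (q : ℕ) (h : ℤ[X]) (M : ℕ) : Matrix (Fin (M + 1)) (Fin (M + 1)) ℝ :=
  Matrix.of fun m m' : Fin (M + 1) => (q : ℝ) ^ min (m : ℕ) m' * (powerSum (frobRoots h) (Nat.dist m m')).re

variable (q : ℕ) (h : ℤ[X]) (M : ℕ)

/-- Power sums of the complex roots of an INTEGER polynomial are real (conjugation-closure,
`frobRoots_map_conj`). [folklore] -/
theorem powerSum_frobRoots_im (n : ℕ) : (powerSum (frobRoots h) n).im = 0 := by
  have hconj : (starRingEnd ℂ) (powerSum (frobRoots h) n) = powerSum (frobRoots h) n := by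
    conv_rhs => rw [← frobRoots_map_conj h]
    unfold powerSum
    rw [map_multiset_sum, Multiset.map_map, Multiset.map_map]
    congr 1
    exact Multiset.map_congr rfl fun α _ => by simp [map_pow]
  exact Complex.conj_eq_iff_im.1 hconj

/-- `Re s_n` cast back to `ℂ` is `s_n`. [folklore] -/
theorem ofReal_powerSum_frobRoots_re (n : ℕ) :
    (((powerSum (frobRoots h) n).re : ℝ) : ℂ) = powerSum (frobRoots h) n :=
  Complex.ext (by simp) (by simp [powerSum_frobRoots_im])

/-- The real lattice matrix is symmetric. [folklore] -/
theorem realLattice_isSymm : (realLattice q h M).IsSymm :=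
  Matrix.IsSymm.ext fun m m' => by simp [realLattice, min_comm, Nat.dist_comm]

/-- `realLattice ⊗ ℂ = latticeMatrix q (frobRoots h) M` (`= D (2 T_M) D`, `latticeMatrix_eq`). [folklore] -/
theorem realLattice_map_ofReal :
    (realLattice q h M).map ((↑) : ℝ → ℂ) = latticeMatrix q (frobRoots h) M := by
  ext m m'
  simp only [realLattice, latticeMatrix, Matrix.map_apply, Matrix.of_apply, Complex.ofReal_mul,
    Complex.ofReal_pow, Complex.ofReal_natCast, ofReal_powerSum_frobRoots_re]

/-- Conjugating by the invertible real diagonal `D = diag((√q)^m)` and scaling by `2` does not change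
positive semidefiniteness: `D (2T) D ⪰ 0 ↔ T ⪰ 0`. [folklore] -/
theorem latticeMatrix_posSemidef_iff (hq : 0 < q) (A : Multiset ℂ) :
    (latticeMatrix q A M).PosSemidef ↔ (ffWindowForm q A M).PosSemidef := by
  have hs : (Real.sqrt q : ℂ) ≠ 0 := by
    exact_mod_cast (Real.sqrt_pos.2 (by exact_mod_cast hq : (0 : ℝ) < q)).ne'
  have hU : IsUnit (sqrtDiag q M) := by
    rw [isUnit_iff_isUnit_det, det_sqrtDiag]
    exact isUnit_iff_ne_zero.2 (pow_ne_zero _ hs)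
  have hstar : star (sqrtDiag q M) = sqrtDiag q M := by
    rw [star_eq_conjTranspose, sqrtDiag, diagonal_conjTranspose]
    congr 1
    funext m
    simp [Complex.conj_ofReal]
  have key := Matrix.IsUnit.posSemidef_star_left_conjugate_iff hU (x := (2 : ℂ) • ffWindowForm q A M)
  rw [hstar] at key
  rw [latticeMatrix_eq hq, key, posSemidef_two_smul_iff]

/-! ## Consequences: Weil positivity as a real quadratic form -/

/-- **`(∀ c, cᵀ S_M^ℝ c ≥ 0) ⟺ T_M(q,h) ⪰ 0`** (`q > 0`). [folklore] -/
theorem realLattice_nonneg_iff_posSemidef (hq : 0 < q) :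
    (∀ c : Fin (M + 1) → ℝ, 0 ≤ c ⬝ᵥ (realLattice q h M *ᵥ c)) ↔ (weilWindowForm (q : ℝ) h M).PosSemidef := by
  rw [← posSemidef_map_ofReal_iff (realLattice_isSymm q h M), realLattice_map_ofReal,
    latticeMatrix_posSemidef_iff q M hq]
  rfl

/-- **RH(q,h) ⇒ every real lattice form is nonnegative** (`weilWindowForm_posSemidef`, ffmirror-2). [folklore] -/
theorem realLattice_nonneg_of_ffRH (hq : 0 < q) (hRH : ∀ α ∈ frobRoots h, ‖α‖ = Real.sqrt q) (M : ℕ) :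
    ∀ c : Fin (M + 1) → ℝ, 0 ≤ c ⬝ᵥ (realLattice q h M *ᵥ c) :=
  (realLattice_nonneg_iff_posSemidef q h M hq).2 (weilWindowForm_posSemidef (by exact_mod_cast hq) hRH M)

/-- **RH(q,h) ⟺ ALL real lattice forms nonnegative**, for an honest datum (`deg h = 2g`, coefficient FE;
`weilWindowForm_posSemidef_depth_iff_ffRH`). [folklore] -/
theorem ffRH_iff_forall_realLattice_nonneg (hq : 0 < q) {g : ℕ} (hdeg : h.natDegree = 2 * g)
    (hFE : ∀ i j, i + j = 2 * g → (q : ℤ) ^ g * h.coeff j = (q : ℤ) ^ i * h.coeff i) :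
    (∀ α ∈ frobRoots h, ‖α‖ = Real.sqrt q)
      ↔ ∀ M : ℕ, ∀ c : Fin (M + 1) → ℝ, 0 ≤ c ⬝ᵥ (realLattice q h M *ᵥ c) := by
  refine ⟨fun hRH M => realLattice_nonneg_of_ffRH q h hq hRH M, fun hall => ?_⟩
  exact (weilWindowForm_posSemidef_depth_iff_ffRH hq hdeg hFE (M := 2 * g) (by omega)).1
    ((realLattice_nonneg_iff_posSemidef q h (2 * g) hq).1 (hall (2 * g)))

/-- **THE LAST WINDOW DECIDES** (`g ≥ 1`): RH(q,h) ⟺ `cᵀ S_{2g-1}^ℝ c ≥ 0` for all real `c`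
(`weilWindowForm_posSemidef_lastWindow_iff_ffRH`). [folklore] -/
theorem ffRH_iff_realLattice_nonneg_lastWindow (hq : 0 < q) {g : ℕ} (hg : 1 ≤ g)
    (hdeg : h.natDegree = 2 * g)
    (hFE : ∀ i j, i + j = 2 * g → (q : ℤ) ^ g * h.coeff j = (q : ℤ) ^ i * h.coeff i) :
    (∀ α ∈ frobRoots h, ‖α‖ = Real.sqrt q)
      ↔ ∀ c : Fin (2 * g - 1 + 1) → ℝ, 0 ≤ c ⬝ᵥ (realLattice q h (2 * g - 1) *ᵥ c) := by
  rw [realLattice_nonneg_iff_posSemidef q h (2 * g - 1) hq]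
  exact (weilWindowForm_posSemidef_lastWindow_iff_ffRH hq hg hdeg hFE).symm

end Summit.RiemannHypothesis.RiemannHypothesis.Theorems.MotivicDoor.FfRealLattice

end
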